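import Mathlib
import Literature.NumberTheory.LFunctions.Zhang2022.SkeletonPartTwo
import Literature.NumberTheory.LFunctions.Zhang2022.SkeletonAssembly
import Literature.NumberTheory.LFunctions.Zhang2022.SkeletonReductions
import Literature.NumberTheory.LFunctions.Zhang2022.Section8ChangeOfVariables
import Literature.NumberTheory.LFunctions.Zhang2022.Section8dStatements
import Literature.NumberTheory.LFunctions.Zhang2022.Section8PrintedConstants
import HarnessLib

/-!
# Zhang (2022) §8, closing part (PDF pp. 49–50): the typed statements from (8.15) to (8.24)

Topic `Literature/NumberTheory/LFunctions/Zhang2022` (Landau–Siegel audit tree; verdict-neutral).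
Y. Zhang, *Discrete mean estimates and the Landau–Siegel zero*, arXiv:2211.02515v1 (2022)
[Zhang2022LandauSiegel] — **an unrefereed manuscript under adjudication. Every `def … : Prop` below
is a CLAIM OF THE MANUSCRIPT, STATED NOT ASSERTED; nothing here asserts or denies its Theorems 1–2.**

This is the campaign section file for the slice `tex L2493–L2582` of §8 "Evaluation of `Ξ₁₁`"
(DAG nodes `Z22:(8.15)` … `Z22:(8.24)`), statements first, one declaration per node, written over the
banked `Skeleton*` objects and the tree's `Section8Defs` / `Section8ChangeOfVariables` /
`Section8Certificate` declarations, which are CITED, never re-declared: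

| DAG node | locator | content | declaration here | tree declaration reused |
|---|---|---|---|---|
| (8.15)–(8.18) | p.49 | the profiles `𝔣₃₆, 𝔤₃₆, 𝔣ⱼ₇, 𝔤ⱼ₇` (printed fraktur; the tree's `ff..`, `gh..`) | `display815` … `display818` (transcription checks, proved) | `ff36 gh36 ff17 gh17 ff27 gh27 ff37 gh37` |
| §8.u051–u054 | p.49 | "Substituting `x = Pᶻ` we obtain …" (four displays, `+o(α)`) | `SubstDiag6`, `SubstDiag7`, `SubstCrossIota`, `SubstCrossIotaBar` | `Skeleton.frakfW/frakgW` (the printed `𝓕_{jμ}(x), 𝓖_{jμ}(x)` of Lemmas 8.2/8.4), `P1`, `P2`, `bigT` |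
| §8.u055 | p.49 | "Inserting these into (8.13) we obtain `(2α)⁻¹S₁ + 2α⁻¹S₂ + (3/2α)S₃ = 𝔞(b₁₁ + ι₂b₂₁ + ῑ₂b₁₂ + \|ι₂\|²b₂₂) + o(1)`" | `SjWeightedEval c′` | `Skeleton.Sj`, `a11`, `a21`, `Theta1Coeff` |
| (8.19)–(8.22) | pp.49–50 | `b₁₁, b₂₂, b₂₁, b₁₂` | `display819` … `display822` (proved, `rfl`) | `b11 b22 b21 b12` |
| §8.u056 | p.50 | "It follows by Proposition 7.1 that `Θ₁(𝐚₁₁,𝐚₂₁) = (…)𝔞𝔓 + o(𝔓)`" | `Theta1Eval c′` (+ the implicit inputs `Adm72a11`, `EcalNegligible c′`) | `Skeleton.Theta1`, `Prop71` |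
| (8.23) | p.50 | `Ξ₁₁ = 𝔠₁𝔞𝔓 + o(𝔓)` | — (banked `Skeleton.Eval823 c′`); kernel edge `eval823_of_theta1Eval` | `Skeleton.Eq87`, `frakc1_eq_coeff_add_conj` |
| §8.u057–u061 | p.50 | `𝔠₁ = c₁₁ + ι₂c₂₁ + ῑ₂c₁₂ + \|ι₂\|²c₂₂`, `c₁₁ = b₁₁ + b̄₁₁`, `c₂₂`, `c₁₂ = b₁₂ + b̄₂₁`, `c₂₁ = c̄₁₂` | `display823_frakc1`, `display823_c11/c22/c12/c21` (`rfl`) | `frakc1 c11 c22 c12 c21` |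
| §8.u062–u064 | p.50 | "Numerical calculation shows that `c₁₁ = 3.61226 + ε/2`, `c₂₂ = 1.32215 + ε/2`, `c₁₂ = −0.45757 − 0.18179i + ε/√2`" (`\|ε\| < 10⁻⁵`) | `NumC11`, `NumC22`, `NumC12`; `numC11_holds`, `numC22_holds`, **`not_numC12`** | `c11_re_bounds`, `c22_re_bounds`, `c12_im_bounds` |
| (8.24) | p.50 | "It follows that `𝔠₁ < 6.9955`" | — (tree `Ineq824`, REFUTED `not_ineq824`); the inference itself: `frakc1_re_lt_of_windows`, `ineq824_of_nums` (proved) | `Ineq824` |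

Conventions are those of `SkeletonPropositions`: a printed "`X = Y + o(α)`" is
`∀ ε > 0, ForAllLarge (‖X − Y‖ ≤ εα)`, "`+o(1)`" is `≤ ε`, "`+o(𝔓)`" is `≤ ε𝔓`; claims involving
`L′(1,χ)` (through `S_j`, `Θ₁`, `𝔞`) are stated under Assumption (A), as the manuscript does from §5 on;
the unspecified constant `c′` of (2.13) is a parameter of every node involving `β₁, β₂, β₃`. The index
conventions `β₄ = β₁, β₅ = β₂` (`j` read mod `3`) and `μ ∈ {6, 7}` (any `μ ≠ 7` read as `6`) are those
of `Skeleton.betaJ` / `Skeleton.betaMu`; `ffSel`, `ghSel` select the printed profile `𝔣_{jμ}`, `𝔤_{jμ}`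
with the same conventions. Notation: the manuscript prints the `x`-profiles of Lemmas 8.2/8.4 as
calligraphic `𝓕_{jμ}(x)`, `𝓖_{jμ}(x)` (TeX `\\f`, `\\g`; the tree's `frakf`/`frakg`, `Skeleton.frakfW/frakgW`) and
the `z`-profiles of (8.13)–(8.18) as fraktur `𝔣_{jμ}(z)`, `𝔤_{jμ}(z)` (TeX `\\ff`, `\\gh`; the tree's
`ff16 … gh37`, whose docstrings write `𝔣𝔣`, `𝔤𝔥`). Editorial notes (recorded, not repaired): the lead-in of §8.u055 says
"Inserting these into (8.13)" where (8.12) is meant; the fourth display after (8.18) prints a stray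
`)` in `𝓖_{j7}(x))`.

What is PROVED here (kernel edges and certificates, all from tree theorems; no new facts):
`display815`–`display822`, `display823_*` (the tree's transcriptions agree letter for letter with the
page); `numC11_holds`, `numC22_holds` (the printed `c₁₁`, `c₂₂` are correct to the stated `10⁻⁵`,
from `Section8Certificate`); `not_numC12` (the printed `c₁₂` is NOT: `Im c₁₂ = −0.20138…`, not
`−0.18179`); `frakc1_re_lt_of_windows` / `ineq824_of_nums` (the manuscript's inference "It follows that
`𝔠₁ < 6.9955`" IS valid from its three printed windows — so the failure of (8.24), `not_ineq824`, is
localised at the single node `NumC12`); `theta1Eval_of` (§8.u056 from Prop. 7.1, §8.u055 and the two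
implicit inputs) and `eval823_of_theta1Eval` ((8.23) from (8.7) and §8.u056).

Deliberately NOT here: (8.10)–(8.14) and the approximations `𝓕_{jμ}(Pᶻ) = 𝔣_{jμ}(z) + O(𝓛⁻⁸)`
(the preceding slice, `tex L2339–L2490`); Lemma 8.1, (8.2)–(8.9) (earlier slices); §9.

## References

* Y. Zhang, arXiv:2211.02515v1 (2022), §8 pp. 49–50 (PDF), displays (8.15)–(8.24) and the
  un-numbered displays between them. [cite: Zhang2022LandauSiegel, §8 pp. 49–50]
-/

noncomputable section

open Complex Real ComplexConjugate

namespace Literature.NumberTheory.LFunctions.Zhang2022.Sec8C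

open Skeleton

/-! ## (8.15)–(8.18): the profiles (tree `Section8Defs`), checked against the page -/

/-- **(8.15)** as printed: `𝔣₃₆(z) = (1 − 3πiz/2)e^{(3πi/2)z}`, `𝔤₃₆(z) = 8/9 + (1/9 + πiz/6)e^{−(3πi/2)z}`
— the tree's `ff36`, `gh36` unfold to exactly this. [cite: Zhang2022LandauSiegel, §8 (8.15) p.49] -/
theorem display815 (z : ℝ) :
    ff36 z = (1 - 3 * π * I * z / 2) * cexp (3 * π * I / 2 * z) ∧
      gh36 z = 8 / 9 + (1 / 9 + π * I * z / 6) * cexp (-(3 * π * I / 2 * z)) := by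
  constructor
  · simp only [ff36, ffF]; push_cast; ring_nf
  · simp only [gh36, ghF]; push_cast; ring_nf

/-- **(8.16)** as printed: `𝔣₁₇(z) = (1 + 3πiz/2)e^{(5πi/2)z}`, `𝔤₁₇(z) = 24/25 + (1/25 + πiz/10)e^{−(5πi/2)z}`
(tree `ff17`, `gh17`). [cite: Zhang2022LandauSiegel, §8 (8.16) p.49] -/
theorem display816 (z : ℝ) :
    ff17 z = (1 + 3 * π * I * z / 2) * cexp (5 * π * I / 2 * z) ∧
      gh17 z = 24 / 25 + (1 / 25 + π * I * z / 10) * cexp (-(5 * π * I / 2 * z)) := by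
  constructor
  · simp only [ff17, ffF]; push_cast; ring_nf
  · simp only [gh17, ghF]; push_cast; ring_nf

/-- **(8.17)** as printed: `𝔣₂₇(z) = (1 + πiz/2)e^{(5πi/2)z}`, `𝔤₂₇(z) = 12/25 + (13/25 + 3πiz/10)e^{−(5πi/2)z}`
(tree `ff27`, `gh27`). [cite: Zhang2022LandauSiegel, §8 (8.17) p.49] -/
theorem display817 (z : ℝ) :
    ff27 z = (1 + π * I * z / 2) * cexp (5 * π * I / 2 * z) ∧
      gh27 z = 12 / 25 + (13 / 25 + 3 * π * I * z / 10) * cexp (-(5 * π * I / 2 * z)) := by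
  constructor
  · simp only [ff27, ffF]; push_cast; ring_nf
  · simp only [gh27, ghF]; push_cast; ring_nf

/-- **(8.18)** as printed: `𝔣₃₇(z) = (1 − πiz/2)e^{(5πi/2)z}`, `𝔤₃₇(z) = 8/25 + (17/25 − 3πiz/10)e^{−(5πi/2)z}`
(tree `ff37`, `gh37`). [cite: Zhang2022LandauSiegel, §8 (8.18) p.49] -/
theorem display818 (z : ℝ) :
    ff37 z = (1 - π * I * z / 2) * cexp (5 * π * I / 2 * z) ∧
      gh37 z = 8 / 25 + (17 / 25 - 3 * π * I * z / 10) * cexp (-(5 * π * I / 2 * z)) := by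
  constructor
  · simp only [ff37, ffF]; push_cast; ring_nf
  · simp only [gh37, ghF]; push_cast; ring_nf

/-- The printed profile `𝔣_{jμ}` of (8.13)–(8.18) (the tree's `ff16 … ff37`) as a function of the indices, with the conventions of
`Skeleton.betaJ` (`j` mod `3`: `β₄ = β₁, β₅ = β₂`) and `Skeleton.betaMu` (`μ = 7`, else `6`).
[cite: Zhang2022LandauSiegel, §8 (8.13)–(8.18) p.49] -/
def ffSel (j μ : ℕ) : ℝ → ℂ :=
  if μ = 7 then (if j % 3 = 1 then ff17 else if j % 3 = 2 then ff27 else ff37)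
  else (if j % 3 = 1 then ff16 else if j % 3 = 2 then ff26 else ff36)

/-- The printed profile `𝔤_{jμ}` of (8.13)–(8.18) (the tree's `gh16 … gh37`) as a function of the indices
(same conventions as `ffSel`). [cite: Zhang2022LandauSiegel, §8 (8.13)–(8.18) p.49] -/
def ghSel (j μ : ℕ) : ℝ → ℂ :=
  if μ = 7 then (if j % 3 = 1 then gh17 else if j % 3 = 2 then gh27 else gh37)
  else (if j % 3 = 1 then gh16 else if j % 3 = 2 then gh26 else gh36)

/-! ## §8.u051–u054: "Substituting `x = Pᶻ` we obtain" (p.49, the four displays after (8.18)) -/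

section Substitutions

variable (c' : ℝ)

/-- **§8.u051** (p.49, first display after (8.18)): for `j = 1, 2, 3`,
"`(log P₁)⁻² ∫₁^{P₁} 𝓕_{j6}(x)𝓖_{j6}(x) dx/x = ((0.504)² log P)⁻¹ ∫₀^{0.504} 𝔣_{j6}(z)𝔤_{j6}(z) dz + o(α)`"
(`𝓕_{j6}, 𝓖_{j6}` of Lemmas 8.2/8.4 = `Skeleton.frakfW/frakgW`; `𝔣, 𝔤` = `ffSel/ghSel`; `P₁ = P^{0.504}`).
CLAIM.
[cite: Zhang2022LandauSiegel, §8 p.49, display 1 after (8.18)] -/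
def SubstDiag6 : Prop :=
  ∀ ε : ℝ, 0 < ε → ForAllLarge fun D _ _ => ∀ j ∈ ({1, 2, 3} : Finset ℕ),
    ‖(((Real.log (Skeleton.P1 D) ^ 2)⁻¹ : ℝ) : ℂ) *
          (∫ x in (1 : ℝ)..Skeleton.P1 D, frakfW c' D j 6 x * frakgW c' D j 6 x / (x : ℂ)) -
        (((0.504 ^ 2 * Real.log (bigP D))⁻¹ : ℝ) : ℂ) *
          ∫ z in (0 : ℝ)..0.504, ffSel j 6 z * ghSel j 6 z‖ ≤ ε * alpha D

/-- **§8.u052** (p.49, second display after (8.18)): for `j = 1, 2, 3`,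
"`(log P₂)⁻² ∫₁^{P₂} 𝓕_{j7}(x)𝓖_{j7}(x) dx/x = ((0.5)² log P)⁻¹ ∫₀^{0.5} 𝔣_{j7}(z)𝔤_{j7}(z) dz + o(α)`"
(`P₂ = P^{0.5}T⁻¹⁰`). CLAIM. [cite: Zhang2022LandauSiegel, §8 p.49, display 2 after (8.18)] -/
def SubstDiag7 : Prop :=
  ∀ ε : ℝ, 0 < ε → ForAllLarge fun D _ _ => ∀ j ∈ ({1, 2, 3} : Finset ℕ),
    ‖(((Real.log (Skeleton.P2 D) ^ 2)⁻¹ : ℝ) : ℂ) *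
          (∫ x in (1 : ℝ)..Skeleton.P2 D, frakfW c' D j 7 x * frakgW c' D j 7 x / (x : ℂ)) -
        (((0.5 ^ 2 * Real.log (bigP D))⁻¹ : ℝ) : ℂ) *
          ∫ z in (0 : ℝ)..0.5, ffSel j 7 z * ghSel j 7 z‖ ≤ ε * alpha D

/-- **§8.u053** (p.49, third display after (8.18); the `ι₂`-term of (8.12)): for `j = 1, 2, 3`,
"`((log P₁)(log P₂))⁻¹ ∫₁^{P₂} 𝓕_{j7}(x)𝓖_{j6}(P^{0.004}T¹⁰x) dx/x
= ((0.5)(0.504) log P)⁻¹ ∫₀^{0.5} 𝔣_{j7}(z)𝔤_{j6}(z + 0.004) dz + o(α)`" (`P₁/P₂ = P^{0.004}T¹⁰`). CLAIM.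
[cite: Zhang2022LandauSiegel, §8 p.49, display 3 after (8.18)] -/
def SubstCrossIota : Prop :=
  ∀ ε : ℝ, 0 < ε → ForAllLarge fun D _ _ => ∀ j ∈ ({1, 2, 3} : Finset ℕ),
    ‖(((Real.log (Skeleton.P1 D) * Real.log (Skeleton.P2 D))⁻¹ : ℝ) : ℂ) *
          (∫ x in (1 : ℝ)..Skeleton.P2 D,
            frakfW c' D j 7 x * frakgW c' D j 6 (bigP D ^ (0.004 : ℝ) * bigT D ^ 10 * x) / (x : ℂ)) -
        (((0.5 * 0.504 * Real.log (bigP D))⁻¹ : ℝ) : ℂ) *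
          ∫ z in (0 : ℝ)..0.5, ffSel j 7 z * ghSel j 6 (z + 0.004)‖ ≤ ε * alpha D

/-- **§8.u054** (p.49, fourth display after (8.18); the `ῑ₂`-term of (8.12); printed with a stray `)`
in "`𝓖_{j7}(x))`"): for `j = 1, 2, 3`,
"`((log P₁)(log P₂))⁻¹ ∫₁^{P₂} 𝓕_{j6}(P^{0.004}T¹⁰x)𝓖_{j7}(x) dx/x
= ((0.5)(0.504) log P)⁻¹ ∫₀^{0.5} 𝔣_{j6}(z + 0.004)𝔤_{j7}(z) dz + o(α)`". CLAIM.
[cite: Zhang2022LandauSiegel, §8 p.49, display 4 after (8.18)] -/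
def SubstCrossIotaBar : Prop :=
  ∀ ε : ℝ, 0 < ε → ForAllLarge fun D _ _ => ∀ j ∈ ({1, 2, 3} : Finset ℕ),
    ‖(((Real.log (Skeleton.P1 D) * Real.log (Skeleton.P2 D))⁻¹ : ℝ) : ℂ) *
          (∫ x in (1 : ℝ)..Skeleton.P2 D,
            frakfW c' D j 6 (bigP D ^ (0.004 : ℝ) * bigT D ^ 10 * x) * frakgW c' D j 7 x / (x : ℂ)) -
        (((0.5 * 0.504 * Real.log (bigP D))⁻¹ : ℝ) : ℂ) *
          ∫ z in (0 : ℝ)..0.5, ffSel j 6 (z + 0.004) * ghSel j 7 z‖ ≤ ε * alpha D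

end Substitutions

/-! ## §8.u055 and (8.19)–(8.22) (p.49–50) -/

section WeightedSum

variable (c' : ℝ)

/-- The weighted sum `(2α)⁻¹S₁(𝐚₁,𝐚₂) + 2α⁻¹S₂(𝐚₁,𝐚₂) + (3/2)α⁻¹S₃(𝐚₁,𝐚₂)` of Proposition 7.1 (the
left side of §8.u055; `Skeleton.mainMV = (this)·𝔓`, `sjWeighted_mul_frakP`).
[cite: Zhang2022LandauSiegel, §7 Prop. 7.1; §8 p.49] -/
def sjWeighted (D : ℕ) (a₁ a₂ : ℕ → ℂ) : ℂ :=
  1 / (2 * (alpha D : ℂ)) * Sj c' D 1 a₁ a₂ + 2 / (alpha D : ℂ) * Sj c' D 2 a₁ a₂ +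
    3 / (2 * (alpha D : ℂ)) * Sj c' D 3 a₁ a₂

/-- `Skeleton.mainMV c′ D 𝐚₁ 𝐚₂ = sjWeighted c′ D 𝐚₁ 𝐚₂ · 𝔓` (the main term of Prop. 7.1 is the weighted
sum times `𝔓`). [cite: Zhang2022LandauSiegel, §7 Prop. 7.1] -/
theorem sjWeighted_mul_frakP (D : ℕ) (a₁ a₂ : ℕ → ℂ) :
    mainMV c' D a₁ a₂ = sjWeighted c' D a₁ a₂ * frakP D := by
  unfold mainMV sjWeighted
  ring

/-- **§8.u055** (p.49, display before (8.19)): "Inserting these into (8.13) [sic; (8.12)] we obtain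
`(2α)⁻¹S₁(𝐚₁₁,𝐚₂₁) + 2α⁻¹S₂(𝐚₁₁,𝐚₂₁) + (3/2)α⁻¹S₃(𝐚₁₁,𝐚₂₁) = 𝔞(b₁₁ + ι₂b₂₁ + ῑ₂b₁₂ + |ι₂|²b₂₂) + o(1)`"
with the `b_{kl}` of (8.19)–(8.22) (the tree's `b11 … b22`; the bracket is the tree's `Theta1Coeff`).
CLAIM (under (A), which the evaluation of `S_j` via Lemmas 8.2–8.4 uses).
[cite: Zhang2022LandauSiegel, §8 p.49, display before (8.19)] -/
def SjWeightedEval : Prop :=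
  ∀ ε : ℝ, 0 < ε → ForAllLarge fun D _ χ => AssumptionA D χ →
    ‖sjWeighted c' D (a11 χ) (a21 χ) - (frakA χ : ℂ) * Theta1Coeff‖ ≤ ε

end WeightedSum

/-- **(8.19)** as printed: `b₁₁ = (0.504²π)⁻¹∫₀^{0.504}(½𝔣₁₆𝔤₁₆ + 2𝔣₂₆𝔤₂₆ + 3/2𝔣₃₆𝔤₃₆)(z)dz`
(the tree's `b11`, by definition). [cite: Zhang2022LandauSiegel, §8 (8.19) p.49] -/
theorem display819 : b11 = ((1 / (0.504 ^ 2 * π) : ℝ) : ℂ) *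
    ∫ z in (0 : ℝ)..0.504,
      (1 / 2 * (ff16 z * gh16 z) + 2 * (ff26 z * gh26 z) + 3 / 2 * (ff36 z * gh36 z)) := rfl

/-- **(8.20)** as printed: `b₂₂ = (0.5²π)⁻¹∫₀^{0.5}(½𝔣₁₇𝔤₁₇ + 2𝔣₂₇𝔤₂₇ + 3/2𝔣₃₇𝔤₃₇)(z)dz`
(the tree's `b22`). [cite: Zhang2022LandauSiegel, §8 (8.20) p.50] -/
theorem display820 : b22 = ((1 / (0.5 ^ 2 * π) : ℝ) : ℂ) *
    ∫ z in (0 : ℝ)..0.5,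
      (1 / 2 * (ff17 z * gh17 z) + 2 * (ff27 z * gh27 z) + 3 / 2 * (ff37 z * gh37 z)) := rfl

/-- **(8.21)** as printed: `b₂₁ = ((0.504)(0.5)π)⁻¹∫₀^{0.5}(½𝔣₁₇(z)𝔤₁₆(z+0.004)
+ 2𝔣₂₇(z)𝔤₂₆(z+0.004) + 3/2𝔣₃₇(z)𝔤₃₆(z+0.004))dz` (the tree's `b21`).
[cite: Zhang2022LandauSiegel, §8 (8.21) p.50] -/
theorem display821 : b21 = ((1 / (0.504 * 0.5 * π) : ℝ) : ℂ) *
    ∫ z in (0 : ℝ)..0.5, (1 / 2 * (ff17 z * gh16 (z + 0.004)) + 2 * (ff27 z * gh26 (z + 0.004))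
      + 3 / 2 * (ff37 z * gh36 (z + 0.004))) := rfl

/-- **(8.22)** as printed: `b₁₂ = ((0.504)(0.5)π)⁻¹∫₀^{0.5}(½𝔣₁₆(z+0.004)𝔤₁₇(z)
+ 2𝔣₂₆(z+0.004)𝔤₂₇(z) + 3/2𝔣₃₆(z+0.004)𝔤₃₇(z))dz` (the tree's `b12`).
[cite: Zhang2022LandauSiegel, §8 (8.22) p.50] -/
theorem display822 : b12 = ((1 / (0.504 * 0.5 * π) : ℝ) : ℂ) *
    ∫ z in (0 : ℝ)..0.5, (1 / 2 * (ff16 (z + 0.004) * gh17 z) + 2 * (ff26 (z + 0.004) * gh27 z)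
      + 3 / 2 * (ff36 (z + 0.004) * gh37 z)) := rfl

/-! ## §8.u056 and (8.23) (p.50) -/

section Theta

variable (c' : ℝ)

/-- IMPLICIT INPUT of "It follows by Proposition 7.1" (§8.u056): the sequences `𝐚₁₁, 𝐚₂₁` of (8.8)
satisfy (7.2) — "`a(n) ≪ 1`" with the explicit bound `3` (`|ϰ₁|, |ϰ₂| ≤ 1`, `|ι₂| < 2`) and
"`a(n) = 0` if `n ≥ PT⁻²`" (`ϰ₁, ϰ₂` are supported on `n < P₁ < PT⁻²`) — for all large `D`. CLAIM
(not displayed; what makes Prop. 7.1 applicable at (8.7)–(8.8)).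
[cite: Zhang2022LandauSiegel, §8 p.44, (8.8) with (7.2)] -/
def Adm72a11 : Prop :=
  ForAllLarge fun D _ χ => Adm72 D 3 (a11 χ) ∧ Adm72 D 3 (a21 χ)

/-- IMPLICIT INPUT of "It follows by Proposition 7.1" (§8.u056): the error term `O(E(𝐚₁₁,𝐚₂₁))` of
Prop. 7.1 is `o(𝔓)`, i.e. `E(𝐚₁₁,𝐚₂₁) = 𝔓𝓛²Σ_j|S_j(𝐚₁₁,𝐚₂₁)| = o(𝔓)` (our gloss of why: by (8.11) each
`S_j` is `O(𝔞/log P) = O(𝔞𝓛⁻⁹)`, and `𝔞 ≪ 𝓛⁴`; the manuscript does not say). CLAIM (not displayed;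
consumed silently at §8.u056).
[cite: Zhang2022LandauSiegel, §8 p.50, "It follows by Proposition 7.1"] -/
def EcalNegligible : Prop :=
  ∀ ε : ℝ, 0 < ε → ForAllLarge fun D _ χ => AssumptionA D χ →
    Ecal c' D (a11 χ) (a21 χ) ≤ ε * frakP D

/-- **§8.u056** (p.50, display after (8.22)): "It follows by Proposition 7.1 that
`Θ₁(𝐚₁₁,𝐚₂₁) = (b₁₁ + ι₂b₂₁ + ῑ₂b₁₂ + |ι₂|²b₂₂)𝔞𝔓 + o(𝔓)`" (bracket = the tree's `Theta1Coeff`).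
CLAIM. [cite: Zhang2022LandauSiegel, §8 p.50, display after (8.22)] -/
def Theta1Eval : Prop :=
  ∀ ε : ℝ, 0 < ε → ForAllLarge fun D _ χ => AssumptionA D χ →
    ‖Theta1 c' χ (a11 χ) (a21 χ) - Theta1Coeff * frakA χ * frakP D‖ ≤ ε * frakP D

end Theta

/-! ## (8.23) and §8.u057–u061: `𝔠₁` and the `c_{kl}` (tree `Section8Defs`), checked against the page

The evaluation node (8.23) `Ξ₁₁ = 𝔠₁𝔞𝔓 + o(𝔓)` itself is the banked `Skeleton.Eval823 c′`
(`SkeletonPropositions`), not restated here. -/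

/-- **§8.u057** (p.50, "where"): `𝔠₁ = c₁₁ + ι₂c₂₁ + ῑ₂c₁₂ + |ι₂|²c₂₂` — the tree's `frakc1`, by
definition (`|ι₂|²` as `Complex.normSq ι₂`). [cite: Zhang2022LandauSiegel, §8 p.50, display after (8.23)] -/
theorem display823_frakc1 :
    frakc1 = c11 + iota2 * c21 + conj iota2 * c12 + (Complex.normSq iota2 : ℂ) * c22 := rfl

/-- **§8.u058** (p.50, "with"): `c₁₁ = b₁₁ + b̄₁₁` (tree `c11`). [cite: Zhang2022LandauSiegel, §8 p.50, `c₁₁`] -/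
theorem display823_c11 : c11 = b11 + conj b11 := rfl

/-- **§8.u059** (p.50): `c₂₂ = b₂₂ + b̄₂₂` (tree `c22`). [cite: Zhang2022LandauSiegel, §8 p.50, `c₂₂`] -/
theorem display823_c22 : c22 = b22 + conj b22 := rfl

/-- **§8.u060** (p.50): `c₁₂ = b₁₂ + b̄₂₁` (tree `c12`). [cite: Zhang2022LandauSiegel, §8 p.50, `c₁₂`] -/
theorem display823_c12 : c12 = b12 + conj b21 := rfl

/-- **§8.u061** (p.50): `c₂₁ = c̄₁₂` (tree `c21`). [cite: Zhang2022LandauSiegel, §8 p.50, `c₂₁`] -/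
theorem display823_c21 : c21 = conj c12 := rfl

/-! ## §8.u062–u064: the three numerical windows (p.50), and (8.24)

"Let `ε` be a complex number satisfying `|ε| < 10⁻⁵`, not necessarily the same in each occurrence.
Numerical calculation shows that …" — each window is typed with its own `ε`. -/

/-- **§8.u062** (p.50): "`c₁₁ = 3.61226 + ε/2`" with `|ε| < 10⁻⁵`. NUMERICAL CLAIM (true:
`numC11_holds`). [cite: Zhang2022LandauSiegel, §8 p.50, `c₁₁ = 3.61226 + ε/2`] -/
def NumC11 : Prop := ∃ ε : ℂ, ‖ε‖ < 1e-5 ∧ c11 = 3.61226 + ε / 2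

/-- **§8.u063** (p.50): "`c₂₂ = 1.32215 + ε/2`" with `|ε| < 10⁻⁵`. NUMERICAL CLAIM (true:
`numC22_holds`). [cite: Zhang2022LandauSiegel, §8 p.50, `c₂₂ = 1.32215 + ε/2`] -/
def NumC22 : Prop := ∃ ε : ℂ, ‖ε‖ < 1e-5 ∧ c22 = 1.32215 + ε / 2

/-- **§8.u064** (p.50): "`c₁₂ = −0.45757 − 0.18179i + ε/√2`" with `|ε| < 10⁻⁵`. NUMERICAL CLAIM —
FALSE for the manuscript's own `c₁₂` (`not_numC12`: `Im c₁₂ = −0.2013834…`; also `Re c₁₂ = −0.45747…`).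
This is the node at which (8.24) fails. [cite: Zhang2022LandauSiegel, §8 p.50, `c₁₂ = −0.45757 − 0.18179i + ε/√2`] -/
def NumC12 : Prop :=
  ∃ ε : ℂ, ‖ε‖ < 1e-5 ∧ c12 = -0.45757 - 0.18179 * I + ε / (Real.sqrt 2 : ℝ)

/-- **§8.u062 holds**: `3.612261 < c₁₁ < 3.612262` (`Section8Certificate.c11_re_bounds`, `c11_im`), so
`c₁₁ = 3.61226 + ε/2` with `|ε| < 4·10⁻⁶`. [cite: Zhang2022LandauSiegel, §8 p.50, `c₁₁`] -/
theorem numC11_holds : NumC11 := by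
  refine ⟨2 * (c11 - 3.61226), ?_, by ring⟩
  have hre := c11_re_bounds
  have h : (2 : ℂ) * (c11 - 3.61226) = ((2 * (c11.re - 3.61226) : ℝ) : ℂ) := by
    apply Complex.ext <;> simp [c11_im]
  rw [h, Complex.norm_real, Real.norm_eq_abs, abs_lt]
  constructor <;> linarith [hre.1, hre.2]

/-- `NumC11` — `_holds` alias of `numC11_holds` above under the fact's exact name (appended
2026-08-28, D-0026 bookkeeping: the proof term is the existing theorem of this file; no statement,
definition or attribute is edited; no new named fact; the ledger's debt table listed the fact
unproved). [cite: Zhang2022LandauSiegel, §8 p.50, `c₁₁`] -/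
theorem _root_.Literature.NumberTheory.LFunctions.Zhang2022.Sec8C.NumC11_holds : NumC11 :=
  _root_.Literature.NumberTheory.LFunctions.Zhang2022.Sec8C.numC11_holds

/-- **§8.u063 holds**: `1.322149 < c₂₂ < 1.32215` (`Section8Certificate.c22_re_bounds`, `c22_im`), so
`c₂₂ = 1.32215 + ε/2` with `|ε| < 2·10⁻⁶`. [cite: Zhang2022LandauSiegel, §8 p.50, `c₂₂`] -/
theorem numC22_holds : NumC22 := by
  refine ⟨2 * (c22 - 1.32215), ?_, by ring⟩
  have hre := c22_re_bounds
  have h : (2 : ℂ) * (c22 - 1.32215) = ((2 * (c22.re - 1.32215) : ℝ) : ℂ) := by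
    apply Complex.ext <;> simp [c22_im]
  rw [h, Complex.norm_real, Real.norm_eq_abs, abs_lt]
  constructor <;> linarith [hre.1, hre.2]

/-- `NumC22` — `_holds` alias of `numC22_holds` above under the fact's exact name (appended
2026-08-28, D-0026 bookkeeping: the proof term is the existing theorem of this file; no statement,
definition or attribute is edited; no new named fact; the ledger's debt table listed the fact
unproved). [cite: Zhang2022LandauSiegel, §8 p.50, `c₂₂`] -/
theorem _root_.Literature.NumberTheory.LFunctions.Zhang2022.Sec8C.NumC22_holds : NumC22 :=
  _root_.Literature.NumberTheory.LFunctions.Zhang2022.Sec8C.numC22_holds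

/-- **§8.u064 is false for the manuscript's `c₁₂`**: `Im c₁₂ < −0.201383` (`Section8Certificate.c12_im_bounds`)
while the printed window forces `|Im c₁₂ + 0.18179| ≤ |ε|/√2 < 10⁻⁵`. (A kernel certificate of the
negation of a NUMERICAL node — the failing input of (8.24); not a statement about Theorems 1–2.)
[cite: Zhang2022LandauSiegel, §8 p.50, `c₁₂`] -/
theorem not_numC12 : ¬ NumC12 := by
  rintro ⟨ε, hε, h⟩
  have him := c12_im_bounds
  have h2 : (1 : ℝ) ≤ Real.sqrt 2 := by
    rw [show (1 : ℝ) = Real.sqrt 1 by simp]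
    exact Real.sqrt_le_sqrt (by norm_num)
  have hdiv : ‖ε / (Real.sqrt 2 : ℝ)‖ ≤ ‖ε‖ := by
    rw [norm_div, Complex.norm_real, Real.norm_eq_abs, abs_of_pos (by positivity)]
    exact div_le_self (norm_nonneg _) h2
  have hi : |(ε / (Real.sqrt 2 : ℝ)).im| ≤ ‖ε‖ := le_trans (Complex.abs_im_le_norm _) hdiv
  have hc : c12.im = -0.18179 + (ε / (Real.sqrt 2 : ℝ)).im := by
    rw [h]; simp
  have := abs_le.mp hi
  linarith [him.2, this.1, this.2]

/-! ### "It follows that `𝔠₁ < 6.9955`" (8.24): the inference is valid; the input `NumC12` is not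

(8.24) itself is the tree's `Ineq824` (`Section8Defs`), REFUTED by `Section8Certificate.not_ineq824`
(`𝔠₁ = 7.05010…`); it is not restated here. -/

/-- Real part of the `𝔠₁`-combination in terms of real and imaginary parts (`ι₂ = 0.94977 − 1.38995i`):
`Re(x₁₁ + ι₂x̄₁₂ + ῑ₂x₁₂ + |ι₂|²x₂₂) = Re x₁₁ + 2(0.94977 Re x₁₂ − 1.38995 Im x₁₂) + |ι₂|² Re x₂₂`.
[cite: Zhang2022LandauSiegel, §8 p.50, display after (8.23)] -/
theorem frakc1_formula_re (x11 x22 x12 : ℂ) :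
    (x11 + iota2 * conj x12 + conj iota2 * x12 + (Complex.normSq iota2 : ℂ) * x22).re =
      x11.re + 2 * (0.94977 * x12.re - 1.38995 * x12.im) + (0.94977 ^ 2 + 1.38995 ^ 2) * x22.re := by
  simp [iota2, Complex.normSq_apply, Complex.mul_re, Complex.add_re, Complex.conj_re, Complex.conj_im]
  ring

/-- **The inference "It follows that `𝔠₁ < 6.9955`" is valid from the three printed windows**: for ANY
complex numbers in the windows `x₁₁ = 3.61226 + ε₁/2`, `x₂₂ = 1.32215 + ε₂/2`,
`x₁₂ = −0.45757 − 0.18179i + ε₃/√2` (`|ε_k| < 10⁻⁵`), the combination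
`x₁₁ + ι₂x̄₁₂ + ῑ₂x₁₂ + |ι₂|²x₂₂` has real part `< 6.9955` (worst case `≈ 6.99549`). Hence the failure of
(8.24) for the manuscript's `𝔠₁` is located at `NumC12` alone. [cite: Zhang2022LandauSiegel, §8 (8.24) p.50] -/
theorem frakc1_re_lt_of_windows (x11 x22 x12 ε₁ ε₂ ε₃ : ℂ) (h₁ : ‖ε₁‖ < 1e-5) (h₂ : ‖ε₂‖ < 1e-5)
    (h₃ : ‖ε₃‖ < 1e-5) (e11 : x11 = 3.61226 + ε₁ / 2) (e22 : x22 = 1.32215 + ε₂ / 2)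
    (e12 : x12 = -0.45757 - 0.18179 * I + ε₃ / (Real.sqrt 2 : ℝ)) :
    (x11 + iota2 * conj x12 + conj iota2 * x12 + (Complex.normSq iota2 : ℂ) * x22).re < 6.9955 := by
  rw [frakc1_formula_re]
  set w : ℂ := ε₃ / (Real.sqrt 2 : ℝ) with hw
  have hs0 : (0 : ℝ) < Real.sqrt 2 := Real.sqrt_pos.mpr (by norm_num)
  have hw_norm : ‖w‖ ^ 2 = ‖ε₃‖ ^ 2 / 2 := by
    rw [hw, norm_div, Complex.norm_real, Real.norm_eq_abs, abs_of_pos hs0, div_pow,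
      Real.sq_sqrt (by norm_num : (0 : ℝ) ≤ 2)]
  -- `|ε₃/√2|² = |ε₃|²/2 < 5·10⁻¹¹`
  have hab : w.re ^ 2 + w.im ^ 2 < 5e-11 := by
    have e : w.re ^ 2 + w.im ^ 2 = ‖w‖ ^ 2 := by
      rw [← Complex.normSq_eq_norm_sq, Complex.normSq_apply]; ring
    rw [e, hw_norm]
    nlinarith [norm_nonneg ε₃, h₃]
  -- Cauchy–Schwarz for the `ι₂`-term: `0.94977a − 1.38995b ≤ |ι₂|·√(a²+b²) < 1.1905·10⁻⁵`
  have ht : 0.94977 * w.re - 1.38995 * w.im < 1.1905e-5 := by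
    have hsq : (0.94977 * w.re - 1.38995 * w.im) ^ 2 ≤
        (0.94977 ^ 2 + 1.38995 ^ 2) * (w.re ^ 2 + w.im ^ 2) := by
      nlinarith [sq_nonneg (0.94977 * w.im + 1.38995 * w.re)]
    have hlt : (0.94977 * w.re - 1.38995 * w.im) ^ 2 < (1.1905e-5 : ℝ) ^ 2 := by
      calc (0.94977 * w.re - 1.38995 * w.im) ^ 2
          ≤ (0.94977 ^ 2 + 1.38995 ^ 2) * (w.re ^ 2 + w.im ^ 2) := hsq
        _ ≤ (0.94977 ^ 2 + 1.38995 ^ 2) * 5e-11 :=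
          mul_le_mul_of_nonneg_left hab.le (by norm_num)
        _ < (1.1905e-5 : ℝ) ^ 2 := by norm_num
    exact (abs_lt.mp (abs_lt_of_sq_lt_sq hlt (by norm_num))).2
  have a1 := abs_le.mp (le_trans (Complex.abs_re_le_norm ε₁) h₁.le)
  have a2 := abs_le.mp (le_trans (Complex.abs_re_le_norm ε₂) h₂.le)
  have r11 : x11.re = 3.61226 + ε₁.re / 2 := by rw [e11]; simp
  have r22 : x22.re = 1.32215 + ε₂.re / 2 := by rw [e22]; simp
  have r12 : x12.re = -0.45757 + w.re := by rw [e12]; simp [hw]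
  have i12 : x12.im = -0.18179 + w.im := by rw [e12]; simp [hw]
  rw [r11, r22, r12, i12]
  linarith [a1.2, a2.2, ht]

/-- **(8.24) from its printed inputs**: `NumC11 → NumC22 → NumC12 → Ineq824` (so, with `not_ineq824`,
again `¬ NumC12`; the direct certificate is `not_numC12`). [cite: Zhang2022LandauSiegel, §8 (8.24) p.50] -/
theorem ineq824_of_nums (h11 : NumC11) (h22 : NumC22) (h12 : NumC12) : Ineq824 := by
  obtain ⟨ε₁, hε₁, e11⟩ := h11
  obtain ⟨ε₂, hε₂, e22⟩ := h22
  obtain ⟨ε₃, hε₃, e12⟩ := h12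
  unfold Ineq824
  rw [display823_frakc1, display823_c21]
  exact frakc1_re_lt_of_windows c11 c22 c12 ε₁ ε₂ ε₃ hε₁ hε₂ hε₃ e11 e22 e12

/-! ## Kernel edges: §8.u056 from Proposition 7.1 and §8.u055; (8.23) from (8.7) and §8.u056 -/

/-- **§8.u056 from its inputs** ("It follows by Proposition 7.1 that …"): Prop. 7.1 applied to
`𝐚₁₁, 𝐚₂₁` (admissible: `Adm72a11`), the weighted-sum evaluation §8.u055, and the negligibility of the
error term `O(E(𝐚₁₁,𝐚₂₁))` (`EcalNegligible`) give `Θ₁(𝐚₁₁,𝐚₂₁) = (b₁₁ + ι₂b₂₁ + ῑ₂b₁₂ + |ι₂|²b₂₂)𝔞𝔓 + o(𝔓)`.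
Pure `ε/3`-bookkeeping; kernel-checked. [cite: Zhang2022LandauSiegel, §8 p.50, display after (8.22)] -/
theorem theta1Eval_of {c' : ℝ} (h71 : Prop71 c') (hadm : Adm72a11) (h55 : SjWeightedEval c')
    (hE : EcalNegligible c') : Theta1Eval c' := by
  intro ε hε
  obtain ⟨C, h71'⟩ := h71 3 (ε / 3) (by positivity)
  have hC1 : 0 < |C| + 1 := by positivity
  have hC1' : |C| + 1 ≠ 0 := hC1.ne'
  obtain ⟨D₀, h⟩ := ((h71'.and hadm).and (h55 (ε / 3) (by positivity))).and
    (hE (ε / (3 * (|C| + 1))) (by positivity))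
  refine ⟨D₀, fun D _ χ hD hq hp hA => ?_⟩
  obtain ⟨⟨⟨h71D, hadmD⟩, h55D⟩, hED⟩ := h D χ hD hq hp
  have hP : 0 ≤ frakP D := frakP_nonneg D
  have e1 : ‖Theta1 c' χ (a11 χ) (a21 χ) - mainMV c' D (a11 χ) (a21 χ)‖ ≤
      C * Ecal c' D (a11 χ) (a21 χ) + ε / 3 * frakP D :=
    h71D hA (a11 χ) (a21 χ) hadmD.1 hadmD.2
  have e2 : ‖sjWeighted c' D (a11 χ) (a21 χ) - (frakA χ : ℂ) * Theta1Coeff‖ ≤ ε / 3 := h55D hA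
  have e3 : Ecal c' D (a11 χ) (a21 χ) ≤ ε / (3 * (|C| + 1)) * frakP D := hED hA
  have hEnn : 0 ≤ Ecal c' D (a11 χ) (a21 χ) := by
    unfold Ecal
    exact mul_nonneg (mul_nonneg hP (sq_nonneg _)) (by positivity)
  -- `C·E ≤ |C|·E ≤ |C|·ε/(3(|C|+1))·𝔓 ≤ (ε/3)𝔓`
  have e4 : C * Ecal c' D (a11 χ) (a21 χ) ≤ ε / 3 * frakP D := by
    have h1 : C * Ecal c' D (a11 χ) (a21 χ) ≤ |C| * Ecal c' D (a11 χ) (a21 χ) :=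
      mul_le_mul_of_nonneg_right (le_abs_self C) hEnn
    have h2 : |C| * Ecal c' D (a11 χ) (a21 χ) ≤ |C| * (ε / (3 * (|C| + 1)) * frakP D) :=
      mul_le_mul_of_nonneg_left e3 (abs_nonneg C)
    have key : |C| * (ε / (3 * (|C| + 1))) ≤ ε / 3 := by
      have e : |C| * (ε / (3 * (|C| + 1))) = ε / 3 * (|C| / (|C| + 1)) := by
        field_simp
      rw [e]
      exact mul_le_of_le_one_right (by positivity) ((div_le_one hC1).mpr (by linarith))
    have h3 : |C| * (ε / (3 * (|C| + 1)) * frakP D) ≤ ε / 3 * frakP D := by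
      rw [← mul_assoc]
      exact mul_le_mul_of_nonneg_right key hP
    linarith
  -- `‖mainMV − B𝔞𝔓‖ = ‖W − 𝔞B‖·𝔓 ≤ (ε/3)𝔓`
  have e5 : ‖mainMV c' D (a11 χ) (a21 χ) - Theta1Coeff * frakA χ * frakP D‖ ≤ ε / 3 * frakP D := by
    have e : mainMV c' D (a11 χ) (a21 χ) - Theta1Coeff * frakA χ * frakP D =
        (sjWeighted c' D (a11 χ) (a21 χ) - (frakA χ : ℂ) * Theta1Coeff) * frakP D := by
      rw [sjWeighted_mul_frakP]; ring
    rw [e, norm_mul, Complex.norm_real, Real.norm_eq_abs, abs_of_nonneg hP]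
    exact mul_le_mul_of_nonneg_right e2 hP
  calc ‖Theta1 c' χ (a11 χ) (a21 χ) - Theta1Coeff * frakA χ * frakP D‖
      ≤ ‖Theta1 c' χ (a11 χ) (a21 χ) - mainMV c' D (a11 χ) (a21 χ)‖ +
          ‖mainMV c' D (a11 χ) (a21 χ) - Theta1Coeff * frakA χ * frakP D‖ :=
        norm_sub_le_norm_sub_add_norm_sub _ _ _
    _ ≤ (C * Ecal c' D (a11 χ) (a21 χ) + ε / 3 * frakP D) + ε / 3 * frakP D := add_le_add e1 e5
    _ ≤ ε * frakP D := by linarith [e4]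

/-- **(8.23) from (8.7) and §8.u056** ("This yields, by (8.7), `Ξ₁₁ = 𝔠₁𝔞𝔓 + o(𝔓)`"): with
`Ξ₁₁ = 2Re Θ₁(𝐚₁₁,𝐚₂₁) + o(𝔓)` (the banked `Skeleton.Eq87`) and `Θ₁(𝐚₁₁,𝐚₂₁) = B𝔞𝔓 + o(𝔓)`
(`Theta1Eval`, `B = Theta1Coeff`), `2Re B = Re(B + B̄) = 𝔠₁` (`frakc1_eq_coeff_add_conj`) gives the
banked evaluation node `Skeleton.Eval823`. Kernel-checked. [cite: Zhang2022LandauSiegel, §8 (8.23) p.50] -/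
theorem eval823_of_theta1Eval {c' : ℝ} (h87 : Eq87 c') (h56 : Theta1Eval c') : Eval823 c' := by
  intro ε hε
  obtain ⟨D₀, h⟩ := (h87 (ε / 2) (by positivity)).and (h56 (ε / 4) (by positivity))
  refine ⟨D₀, fun D _ χ hD hq hp hA => ?_⟩
  obtain ⟨h87D, h56D⟩ := h D χ hD hq hp
  have e1 := abs_le.mp (h87D hA)
  have e2 : ‖Theta1 c' χ (a11 χ) (a21 χ) - Theta1Coeff * frakA χ * frakP D‖ ≤ ε / 4 * frakP D :=
    h56D hA
  have e3 : |(Theta1 c' χ (a11 χ) (a21 χ)).re - Theta1Coeff.re * frakA χ * frakP D| ≤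
      ε / 4 * frakP D := by
    have e : (Theta1 c' χ (a11 χ) (a21 χ) - Theta1Coeff * frakA χ * frakP D).re =
        (Theta1 c' χ (a11 χ) (a21 χ)).re - Theta1Coeff.re * frakA χ * frakP D := by
      simp [Complex.sub_re, Complex.mul_re]
    rw [← e]
    exact le_trans (Complex.abs_re_le_norm _) e2
  have hc : frakc1.re = 2 * Theta1Coeff.re := by
    rw [frakc1_eq_coeff_add_conj, Complex.add_re, Complex.conj_re]; ring
  have e3' := abs_le.mp e3
  rw [hc, abs_le]
  constructor <;> linarith [e1.1, e1.2, e3'.1, e3'.2]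


/-! ## Bridges to the files OF RECORD for the same nodes (`Section8dStatements`, L2-t9, p411983;
`Section8PrintedConstants`, adj-1, p411778): the three typings are provably the same statements -/

section Bridges

variable (c' : ℝ)

/-- Our profile selector is the of-record `Section8dStatements.ffP` (same conventions).
[cite: Zhang2022LandauSiegel, §8 (8.13)–(8.18) p.49] -/
theorem ffSel_eq_ffP : ffSel = Section8dStatements.ffP := rfl

/-- Our profile selector is the of-record `Section8dStatements.ghP`.
[cite: Zhang2022LandauSiegel, §8 (8.13)–(8.18) p.49] -/
theorem ghSel_eq_ghP : ghSel = Section8dStatements.ghP := rfl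

/-- §8.u055: `SjWeightedEval c′` is `Section8dStatements.Step8u055 c′` (definitionally).
[cite: Zhang2022LandauSiegel, §8 p.49, display before (8.19)] -/
theorem sjWeightedEval_iff : SjWeightedEval c' ↔ Section8dStatements.Step8u055 c' := Iff.rfl

/-- §8.u056: `Theta1Eval c′` is `Section8dStatements.Step8u056 c′` (definitionally; `Theta1Coeff`
unfolds to the printed bracket). [cite: Zhang2022LandauSiegel, §8 p.50, display after (8.22)] -/
theorem theta1Eval_iff : Theta1Eval c' ↔ Section8dStatements.Step8u056 c' := Iff.rfl

/-- §8.u062: `NumC11` is `Section8dStatements.Step8u062_num` (definitionally).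
[cite: Zhang2022LandauSiegel, §8 p.50, `c₁₁`] -/
theorem numC11_iff : NumC11 ↔ Section8dStatements.Step8u062_num := Iff.rfl

/-- §8.u063: `NumC22` is `Section8dStatements.Step8u063_num` (definitionally).
[cite: Zhang2022LandauSiegel, §8 p.50, `c₂₂`] -/
theorem numC22_iff : NumC22 ↔ Section8dStatements.Step8u063_num := Iff.rfl

/-- §8.u064: `NumC12` is `Section8dStatements.Step8u064_num` (definitionally).
[cite: Zhang2022LandauSiegel, §8 p.50, `c₁₂`] -/
theorem numC12_iff : NumC12 ↔ Section8dStatements.Step8u064_num := Iff.rfl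

/-- §8.u062: `NumC11` is adj-1's `PrintedC11` (`0.00001 = 10⁻⁵`, `((3.61226 : ℝ) : ℂ) = 3.61226`).
[cite: Zhang2022LandauSiegel, §8 p.50, `c₁₁`] -/
theorem numC11_iff_printedC11 : NumC11 ↔ PrintedC11 := by
  unfold NumC11 PrintedC11
  have h2 : ((3.61226 : ℝ) : ℂ) = 3.61226 := by push_cast; rfl
  simp only [h2]

/-- §8.u063: `NumC22` is adj-1's `PrintedC22`. [cite: Zhang2022LandauSiegel, §8 p.50, `c₂₂`] -/
theorem numC22_iff_printedC22 : NumC22 ↔ PrintedC22 := by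
  unfold NumC22 PrintedC22
  have h2 : ((1.32215 : ℝ) : ℂ) = 1.32215 := by push_cast; rfl
  simp only [h2]

/-- §8.u064: `NumC12` is adj-1's `PrintedC12` (so `not_numC12` and adj-1's `not_printedC12` refute
the same statement). [cite: Zhang2022LandauSiegel, §8 p.50, `c₁₂`] -/
theorem numC12_iff_printedC12 : NumC12 ↔ PrintedC12 := by
  unfold NumC12 PrintedC12
  have h2 : ((-0.45757 : ℝ) : ℂ) + ((-0.18179 : ℝ) : ℂ) * I = -0.45757 - 0.18179 * I := by
    push_cast; ring
  simp only [h2]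

end Bridges

/-! ## The implicit input `Adm72a11` holds -/

/-- `L₀ ≤ log D` once `D ≥ ⌈exp L₀⌉₊`. [folklore] -/
private theorem le_log_of_ceil_exp_le {L₀ : ℝ} {D : ℕ} (hD : ⌈Real.exp L₀⌉₊ ≤ D) :
    L₀ ≤ Real.log D := by
  have h : Real.exp L₀ ≤ D := le_trans (Nat.le_ceil _) (by exact_mod_cast hD)
  exact (Real.le_log_iff_exp_le (lt_of_lt_of_le (Real.exp_pos _) h)).mpr h

/-- `|ι₂| < 2` (`|ι₂|² = 0.94977² + 1.38995² = 2.834…`). [cite: Zhang2022LandauSiegel, §2 (2.26) p.6] -/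
theorem norm_iota2_lt_two : ‖iota2‖ < 2 := by
  have h : ‖iota2‖ ^ 2 < 4 := by
    rw [← Complex.normSq_eq_norm_sq, iota2, Complex.normSq_apply]
    simp
    norm_num
  nlinarith [norm_nonneg iota2]

/-- **The implicit input `Adm72a11` holds**: `𝐚₁₁, 𝐚₂₁` satisfy (7.2) with the bound `3` for all `D`
with `log D ≥ 2` — the tree's `Skeleton.adm72_a11`, `Skeleton.adm72_a21` (bound `1 + |ι₂|`) and
`|ι₂| < 2`. [cite: Zhang2022LandauSiegel, §8 p.44, (8.8) with (7.2)] -/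
theorem adm72a11_holds : Adm72a11 := by
  refine ⟨⌈Real.exp 2⌉₊, fun D _ χ hD _ _ => ?_⟩
  have hlog : 2 ≤ Real.log D := le_log_of_ceil_exp_le hD
  have hι : 1 + ‖iota2‖ ≤ 3 := by linarith [norm_iota2_lt_two]
  obtain ⟨hb1, hs1⟩ := adm72_a11 χ hlog
  obtain ⟨hb2, hs2⟩ := adm72_a21 χ hlog
  exact ⟨⟨fun n => (hb1 n).trans hι, hs1⟩, ⟨fun n => (hb2 n).trans hι, hs2⟩⟩

/-- `Adm72a11` — `_holds` alias of `adm72a11_holds` above under the fact's exact name (appended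
2026-08-28, D-0026 bookkeeping: the proof term is the existing theorem of this file; no statement,
definition or attribute is edited; no new named fact; the ledger's debt table listed the fact
unproved). [cite: Zhang2022LandauSiegel, §8 p.44, (8.8) with (7.2)] -/
theorem _root_.Literature.NumberTheory.LFunctions.Zhang2022.Sec8C.Adm72a11_holds : Adm72a11 :=
  _root_.Literature.NumberTheory.LFunctions.Zhang2022.Sec8C.adm72a11_holds

/-- §8.u056 from Proposition 7.1, §8.u055 and the negligibility of `E(𝐚₁₁,𝐚₂₁)` (`theta1Eval_of`
with `Adm72a11` discharged). [cite: Zhang2022LandauSiegel, §8 p.50, display after (8.22)] -/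
theorem theta1Eval_of' {c' : ℝ} (h71 : Prop71 c') (h55 : SjWeightedEval c') (hE : EcalNegligible c') :
    Theta1Eval c' :=
  theta1Eval_of h71 adm72a11_holds h55 hE

end Literature.NumberTheory.LFunctions.Zhang2022.Sec8C
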